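/-
Copyright (c) 2026. All rights reserved.
Released under Apache 2.0 license as described in the file LICENSE.
Authors: abc-iut cell — seat abc-iut-L6-t15 (gen 3): proof-only companion to `HolomorphicCores`
([AbsTopIII] Prop 2.5), no new definitions.
-/
import Literature.AnabelianGeometry.AbsoluteAnabelian.ParallelogramsPlanarSegments
import Mathlib.Topology.MetricSpace.Thickening

/-!
# Planar geometry behind [AbsTopIII] Prop 2.5, III: closed segments in `U` are line segments

Proof-only companion (no definitions) to `HolomorphicCores.lean`, continuing
`ParallelogramsPlanarSegments`.  For an open `U ⊆ ℂ` and `𝒬 = 𝒮(U)`: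

* parallelograms translated in their own frame; two squares sharing an edge have disjoint interiors and
  their closures meet exactly in the common edge — so a short closed segment in `U` is a STRICT line
  segment of `(U, 𝒮(U))`;
* Prop 2.5 (a), converse direction: every non-degenerate closed segment `[a, b] ⊆ U` is a LINE SEGMENT of
  `(U, 𝒮(U))` (subdivide `[a, b]` into short overlapping pieces, each a strict line segment; they form a
  strict chain).  Together with part II: the line segments of `(U, 𝒮(U))` are exactly the non-degenerate
  closed segments contained in `U`.

Refereed classical mathematics (S. Mochizuki, *Topics in absolute anabelian geometry III*, §2; kurims
pages); nothing here bears on the disputed parts of IUT.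
-/

namespace Literature.AnabelianGeometry.AbsoluteAnabelian

open _root_.Complex _root_.Set _root_.Topology _root_.Filter _root_.Metric

noncomputable section

/-! ### Parallelograms translated in their own frame; adjacent parallelograms -/

/-- A parallelogram translated by `a v + b w` is the image of the translated unit square under the frame of
`(z, v, w)`. (Auxiliary.) [cite: MochizukiAbsTopIII2015, Proposition 2.5 (proof) pp.55–57] -/
theorem openParallelogram_translate_eq_image {z v w : ℂ} {A : ℂ → ℂ}
    (hA : ∀ p : ℂ, A p = z + (p.re : ℂ) * v + (p.im : ℂ) * w) (a b : ℝ) :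
    openParallelogram (z + (a : ℂ) * v + (b : ℂ) * w) v w = A '' (Ioo a (a + 1) ×ℂ Ioo b (b + 1)) := by
  ext x
  simp only [openParallelogram, mem_setOf_eq, mem_image, mem_reProdIm, mem_Ioo]
  constructor
  · rintro ⟨s, t, hs, hs', ht, ht', rfl⟩
    refine ⟨⟨a + s, b + t⟩, ⟨⟨by linarith, by linarith⟩, by linarith, by linarith⟩, ?_⟩
    rw [hA]; push_cast; ring
  · rintro ⟨p, ⟨⟨h1, h2⟩, h3, h4⟩, rfl⟩
    refine ⟨p.re - a, p.im - b, by linarith, by linarith, by linarith, by linarith, ?_⟩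
    rw [hA]; push_cast; ring

/-- Closure of a parallelogram translated in its own frame.
(Auxiliary.) [cite: MochizukiAbsTopIII2015, Proposition 2.5 (proof) pp.55–57] -/
theorem closure_openParallelogram_translate {z v w : ℂ} (h : LinearIndependent ℝ ![v, w]) {A : ℂ → ℂ}
    (hA : ∀ p : ℂ, A p = z + (p.re : ℂ) * v + (p.im : ℂ) * w) (a b : ℝ) :
    closure (openParallelogram (z + (a : ℂ) * v + (b : ℂ) * w) v w) =
      A '' (Icc a (a + 1) ×ℂ Icc b (b + 1)) := by
  obtain ⟨B, hB⟩ := exists_homeomorph_frame z v w h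
  have hAB : A = ⇑B := funext fun p => by rw [hA, hB]
  rw [openParallelogram_translate_eq_image hA, hAB, ← B.image_closure, Complex.closure_reProdIm,
    closure_Ioo (lt_add_one a).ne, closure_Ioo (lt_add_one b).ne]

/-- Intersection of two boxes `s ×ℂ t`. (Auxiliary.) [cite: MochizukiAbsTopIII2015, Proposition 2.5 (proof) pp.55–57] -/
theorem reProdIm_inter_reProdIm (s t s' t' : Set ℝ) :
    (s ×ℂ t) ∩ (s' ×ℂ t') = (s ∩ s') ×ℂ (t ∩ t') := by
  ext x; simp only [mem_inter_iff, mem_reProdIm]; tauto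

/-- The frame maps the bottom edge `[0,1] × {0}` of the unit square onto the segment `[z, z + v]`.
(Auxiliary.) [cite: MochizukiAbsTopIII2015, Proposition 2.5 (proof) pp.55–57] -/
theorem image_frame_Icc_zero {z v w : ℂ} {A : ℂ → ℂ}
    (hA : ∀ p : ℂ, A p = z + (p.re : ℂ) * v + (p.im : ℂ) * w) :
    A '' (Icc 0 1 ×ℂ {(0 : ℝ)}) = segment ℝ z (z + v) := by
  rw [segment_eq_image_lineMap]
  ext x
  simp only [mem_image, mem_reProdIm, mem_singleton_iff, mem_Icc]
  constructor
  · rintro ⟨p, ⟨hp, hp0⟩, rfl⟩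
    refine ⟨p.re, hp, ?_⟩
    rw [lineMap_apply_complex, hA, hp0]; push_cast; ring
  · rintro ⟨θ, hθ, rfl⟩
    refine ⟨⟨θ, 0⟩, ⟨hθ, rfl⟩, ?_⟩
    rw [lineMap_apply_complex, hA]; push_cast; ring

/-- Two parallelograms with the same edge vectors, one on each side of the edge `[z, z + v]`, are
disjoint. (Auxiliary.) [cite: MochizukiAbsTopIII2015, Proposition 2.5 (proof) pp.55–57] -/
theorem disjoint_openParallelogram_sub {z v w : ℂ} (h : LinearIndependent ℝ ![v, w]) :
    Disjoint (openParallelogram z v w) (openParallelogram (z - w) v w) := by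
  obtain ⟨A, hA⟩ := exists_homeomorph_frame z v w h
  have h1 := openParallelogram_translate_eq_image hA 0 0
  have h2 := openParallelogram_translate_eq_image hA 0 (-1)
  simp only [Complex.ofReal_zero, zero_mul, add_zero, Complex.ofReal_neg, Complex.ofReal_one, neg_mul,
    one_mul, zero_add, ← sub_eq_add_neg, neg_add_cancel] at h1 h2
  rw [h1, h2, disjoint_image_iff A.injective]
  exact Set.disjoint_left.2 fun p hp hp' => by
    simp only [mem_reProdIm, mem_Ioo] at hp hp'
    linarith [hp.2.1, hp'.2.2]

/-- Two parallelograms with the same edge vectors, one on each side of the edge `[z, z + v]`: their closures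
meet exactly in that edge. (Auxiliary.) [cite: MochizukiAbsTopIII2015, Proposition 2.5 (proof) pp.55–57] -/
theorem closure_inter_closure_openParallelogram_sub {z v w : ℂ} (h : LinearIndependent ℝ ![v, w]) :
    closure (openParallelogram z v w) ∩ closure (openParallelogram (z - w) v w) =
      segment ℝ z (z + v) := by
  obtain ⟨A, hA⟩ := exists_homeomorph_frame z v w h
  have h1 := closure_openParallelogram_translate h hA 0 0
  have h2 := closure_openParallelogram_translate h hA 0 (-1)
  simp only [Complex.ofReal_zero, zero_mul, add_zero, Complex.ofReal_neg, Complex.ofReal_one, neg_mul,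
    one_mul, zero_add, ← sub_eq_add_neg, neg_add_cancel] at h1 h2
  rw [h1, h2, ← image_inter A.injective, reProdIm_inter_reProdIm, inter_self, Icc_inter_Icc,
    ← image_frame_Icc_zero hA]
  norm_num

/-! ### Prop 2.5 (a): closed segments in `U` are line segments -/

/-- Membership in a segment from an explicit parametrisation.
(Auxiliary.) [cite: MochizukiAbsTopIII2015, Proposition 2.5 (proof) pp.55–57] -/
theorem mem_segment_of_eq_add_mul {p q x : ℂ} {μ : ℝ} (hμ0 : 0 ≤ μ) (hμ1 : μ ≤ 1)
    (hx : x = p + (μ : ℂ) * (q - p)) : x ∈ segment ℝ p q := by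
  rw [segment_eq_image_lineMap]
  exact ⟨μ, ⟨hμ0, hμ1⟩, by rw [lineMap_apply_complex, hx]⟩

/-- A non-degenerate closed segment in `ℂ` is infinite.
(Auxiliary.) [cite: MochizukiAbsTopIII2015, Proposition 2.5 (proof) pp.55–57] -/
theorem segment_infinite {p q : ℂ} (hpq : p ≠ q) : (segment ℝ p q).Infinite := by
  rw [segment_eq_image_lineMap]
  exact (Icc_infinite zero_lt_one).image (lineMap_injective_complex hpq).injOn

/-- The trace on `U` of a subset of `U` is infinite iff the subset is.
(Auxiliary.) [cite: MochizukiAbsTopIII2015, Proposition 2.5 (proof) pp.55–57] -/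
theorem preimage_val_infinite {U S : Set ℂ} (hSU : S ⊆ U) (hS : S.Infinite) :
    (Subtype.val ⁻¹' S : Set U).Infinite := by
  refine Set.Infinite.of_image Subtype.val ?_
  rwa [image_preimage_eq_inter_range, Subtype.range_coe, inter_eq_left.2 hSU]

/-- **Prop 2.5 (a)**, short segments: if the two squares on either side of the edge `[z, z + v]` (`v ≠ 0`) have
closures inside the open set `U`, then (the trace on `U` of) `[z, z + v]` is a STRICT line segment of
`(U, 𝒮(U))`. [cite: MochizukiAbsTopIII2015, Proposition 2.5 (a) p.56] -/
theorem Parallelograms.isStrictLineSegment_of_squares_subset {U : Set ℂ} (hU : IsOpen U)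
    {𝒬 : Set (Set U)} (h𝒬 : ∀ Q ∈ 𝒬, Subtype.val '' Q ∈ parallelogramsIn U)
    (h𝒮 : ∀ Q : Set U, Subtype.val '' Q ∈ squaresIn U → Q ∈ 𝒬) {z v : ℂ}
    (hv : v ≠ 0) (h₁ : closure (openParallelogram z v (I * v)) ⊆ U)
    (h₂ : closure (openParallelogram (z - I * v) v (I * v)) ⊆ U) :
    Parallelograms.IsStrictLineSegment 𝒬 (Subtype.val ⁻¹' segment ℝ z (z + v)) := by
  have hli := linearIndependent_pair_mul_I hv
  have him : ∀ {P : Set ℂ}, closure P ⊆ U →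
      Subtype.val '' (Subtype.val ⁻¹' P : Set U) = P := fun hP => by
    rw [image_preimage_eq_inter_range, Subtype.range_coe, inter_eq_left.2 (subset_closure.trans hP)]
  have hseg := closure_inter_closure_openParallelogram_sub (z := z) hli
  refine ⟨Subtype.val ⁻¹' openParallelogram z v (I * v), h𝒮 _ ⟨z, v, hv, (him h₁).symm ▸ ⟨rfl, h₁⟩⟩,
    Subtype.val ⁻¹' openParallelogram (z - I * v) v (I * v),
    h𝒮 _ ⟨z - I * v, v, hv, (him h₂).symm ▸ ⟨rfl, h₂⟩⟩,
    disjoint_iff_inter_eq_empty.1 ((disjoint_openParallelogram_sub hli).preimage _), ?_, ?_⟩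
  · rw [Parallelograms.topology_eq_of_subset hU h𝒬 h𝒮,
      Topology.IsInducing.subtypeVal.closure_eq_preimage_closure_image,
      Topology.IsInducing.subtypeVal.closure_eq_preimage_closure_image, him h₁, him h₂,
      ← preimage_inter, hseg]
  · exact preimage_val_infinite (hseg.symm.le.trans (inter_subset_left.trans h₁))
      (segment_infinite (by simpa using hv))

/-- **Prop 2.5 (a)**, converse: every non-degenerate closed segment `[a, b]` contained in the open set `U`
is (the image of) a LINE SEGMENT of `(U, 𝒮(U))` — subdivide `[a, b]` into short overlapping pieces, each a
strict line segment by `isStrictLineSegment_of_squares_subset`; consecutive pieces overlap in a segment,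
so they form a strict chain. [cite: MochizukiAbsTopIII2015, Proposition 2.5 (a) p.56] -/
theorem Parallelograms.isLineSegment_of_segment_subset {U : Set ℂ} (hU : IsOpen U)
    {𝒬 : Set (Set U)} (h𝒬 : ∀ Q ∈ 𝒬, Subtype.val '' Q ∈ parallelogramsIn U)
    (h𝒮 : ∀ Q : Set U, Subtype.val '' Q ∈ squaresIn U → Q ∈ 𝒬) {a b : ℂ}
    (hab : a ≠ b) (hsub : segment ℝ a b ⊆ U) :
    Parallelograms.IsLineSegment 𝒬 (Subtype.val ⁻¹' segment ℝ a b) := by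
  have hcpt : IsCompact (segment ℝ a b) := by
    -- (also available as `Literature.Probability.Percolation.isCompact_segment_complex`; not imported here)
    rw [segment_eq_image_lineMap]; exact isCompact_Icc.image AffineMap.lineMap_continuous
  obtain ⟨ε, hε, hthick⟩ := hcpt.exists_cthickening_subset_open hU hsub
  -- `K + 1` pieces of length `2‖h‖`, where `(K + 2) h = b - a`
  set K : ℕ := ⌈2 * ‖b - a‖ / ε⌉₊ + 1 with hK
  set n : ℕ := K + 2 with hn
  have hnpos : (0 : ℝ) < n := by positivity
  have hnC : (n : ℂ) ≠ 0 := by exact_mod_cast hnpos.ne'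
  set h : ℂ := (b - a) / (n : ℂ) with hh
  have hnh : (n : ℂ) * h = b - a := by rw [hh]; field_simp
  have hba : b - a ≠ 0 := sub_ne_zero.2 (Ne.symm hab)
  have hh0 : h ≠ 0 := by rw [hh]; exact div_ne_zero hba hnC
  have h2h0 : (2 : ℂ) * h ≠ 0 := mul_ne_zero two_ne_zero hh0
  have hnorm : ‖(2 : ℂ) * h‖ ≤ ε := by
    have hceil : 2 * ‖b - a‖ / ε ≤ n := by
      rw [hn, hK]; push_cast
      linarith [Nat.le_ceil (2 * ‖b - a‖ / ε)]
    rw [norm_mul, hh, norm_div, Complex.norm_natCast, Complex.norm_two, ← mul_div_assoc,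
      div_le_iff₀ hnpos]
    rw [div_le_iff₀ hε] at hceil
    linarith
  set c : ℕ → ℂ := fun k => a + (k : ℂ) * h with hc
  -- points of the pieces lie on `[a, b]`
  have hcseg : ∀ (k : ℕ) (s : ℝ), 0 ≤ s → (k : ℝ) + s ≤ n → c k + (s : ℂ) * h ∈ segment ℝ a b := by
    intro k s hs hks
    refine mem_segment_of_eq_add_mul (μ := ((k : ℝ) + s) / n) (by positivity)
      (by rwa [div_le_one hnpos]) ?_
    rw [← hnh, hc]; push_cast; field_simp; ring
  -- the two squares flanking piece `k` have closures inside `U`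
  have hsq : ∀ k : ℕ, k ≤ K →
      closure (openParallelogram (c k) (2 * h) (I * (2 * h))) ⊆ U ∧
        closure (openParallelogram (c k - I * (2 * h)) (2 * h) (I * (2 * h))) ⊆ U := by
    intro k hk
    have hli := linearIndependent_pair_mul_I h2h0
    have hkK : (k : ℝ) + 2 ≤ n := by rw [hn]; push_cast; linarith [(Nat.cast_le (α := ℝ)).2 hk]
    have hdist : ∀ s t : ℝ, 0 ≤ s → s ≤ 1 → |t| ≤ 1 →
        c k + (s : ℂ) * (2 * h) + (t : ℂ) * (I * (2 * h)) ∈ U := by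
      intro s t hs hs1 ht
      apply hthick
      refine Metric.mem_cthickening_of_dist_le _ (c k + ((2 * s : ℝ) : ℂ) * h) ε _
        (hcseg k (2 * s) (by positivity) (by linarith)) ?_
      rw [dist_eq_norm]
      have : c k + (s : ℂ) * (2 * h) + (t : ℂ) * (I * (2 * h)) - (c k + ((2 * s : ℝ) : ℂ) * h) =
          (t : ℂ) * (I * (2 * h)) := by push_cast; ring
      rw [this, norm_mul, norm_mul, Complex.norm_I, one_mul, Complex.norm_real, Real.norm_eq_abs]
      calc |t| * ‖(2 : ℂ) * h‖ ≤ 1 * ‖(2 : ℂ) * h‖ := by gcongr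
        _ ≤ ε := by rw [one_mul]; exact hnorm
    constructor
    · intro x hx
      rw [mem_closure_openParallelogram_iff hli] at hx
      obtain ⟨s, t, hs, hs1, ht, ht1, rfl⟩ := hx
      exact hdist s t hs hs1 (by rw [abs_le]; constructor <;> linarith)
    · intro x hx
      rw [mem_closure_openParallelogram_iff hli] at hx
      obtain ⟨s, t, hs, hs1, ht, ht1, rfl⟩ := hx
      have : c k - I * (2 * h) + (s : ℂ) * (2 * h) + (t : ℂ) * (I * (2 * h)) =
          c k + (s : ℂ) * (2 * h) + ((t - 1 : ℝ) : ℂ) * (I * (2 * h)) := by push_cast; ring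
      rw [this]
      exact hdist s (t - 1) hs hs1 (by rw [abs_le]; constructor <;> linarith)
  have hstrict : ∀ k : ℕ, k ≤ K →
      Parallelograms.IsStrictLineSegment 𝒬 (Subtype.val ⁻¹' segment ℝ (c k) (c k + 2 * h)) :=
    fun k hk =>
      Parallelograms.isStrictLineSegment_of_squares_subset hU h𝒬 h𝒮 h2h0 (hsq k hk).1 (hsq k hk).2
  have hpiece_sub : ∀ k : ℕ, k ≤ K → segment ℝ (c k) (c k + 2 * h) ⊆ segment ℝ a b := by
    intro k hk
    have hkK : (k : ℝ) + 2 ≤ n := by rw [hn]; push_cast; linarith [(Nat.cast_le (α := ℝ)).2 hk]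
    refine (convex_segment a b).segment_subset ?_ ?_
    · simpa using hcseg k 0 le_rfl (by linarith)
    · simpa using hcseg k 2 (by norm_num) hkK
  refine ⟨(List.range (K + 1)).map fun k => Subtype.val ⁻¹' segment ℝ (c k) (c k + 2 * h),
    ⟨?_, ?_, ?_⟩, ?_⟩
  · rw [List.length_map, List.length_range]; omega
  · intro L hL
    obtain ⟨k, hk, rfl⟩ := List.mem_map.1 hL
    exact hstrict k (by have := List.mem_range.1 hk; omega)
  · rw [List.isChain_map]
    refine (List.isChain_range_succ _ K).2 fun m hm => ?_
    show (Subtype.val ⁻¹' segment ℝ (c m) (c m + 2 * h) ∩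
      Subtype.val ⁻¹' segment ℝ (c (m + 1)) (c (m + 1) + 2 * h) : Set U).Infinite
    have e1 : c (m + 1) = c m + h := by rw [hc]; push_cast; ring
    have hT : segment ℝ (c m + h) (c m + 2 * h) ⊆
        segment ℝ (c m) (c m + 2 * h) ∩ segment ℝ (c (m + 1)) (c (m + 1) + 2 * h) := by
      rw [e1]
      refine subset_inter ((convex_segment _ _).segment_subset ?_ (right_mem_segment _ _ _))
        ((convex_segment _ _).segment_subset (left_mem_segment _ _ _) ?_)
      · exact mem_segment_of_eq_add_mul (μ := 2⁻¹) (by norm_num) (by norm_num) (by push_cast; ring)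
      · exact mem_segment_of_eq_add_mul (μ := 2⁻¹) (by norm_num) (by norm_num) (by push_cast; ring)
    have hmK : (m : ℝ) + 2 ≤ n := by
      rw [hn]; push_cast; linarith [(Nat.cast_lt (α := ℝ)).2 hm]
    refine Set.Infinite.mono (by rw [← preimage_inter]; exact preimage_mono hT)
      (preimage_val_infinite ?_ (segment_infinite ?_))
    · refine ((convex_segment a b).segment_subset ?_ ?_).trans hsub
      · simpa using hcseg m 1 zero_le_one (by linarith)
      · simpa using hcseg m 2 (by norm_num) hmK
    · intro heq
      apply hh0
      linear_combination -heq
  · ext x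
    simp only [mem_preimage, mem_iUnion, List.mem_map, List.mem_range, exists_prop]
    constructor
    · intro hx
      rw [segment_eq_image_lineMap] at hx
      obtain ⟨θ, ⟨hθ0, hθ1⟩, hθx⟩ := hx
      set u : ℝ := θ * n with hu
      set k : ℕ := min ⌊u⌋₊ K with hk
      have hkK : k ≤ K := min_le_right _ _
      refine ⟨_, ⟨k, by omega, rfl⟩, ?_⟩
      show (x : ℂ) ∈ segment ℝ (c k) (c k + 2 * h)
      have hu0 : 0 ≤ u := by positivity
      have hun : u ≤ n := by rw [hu]; nlinarith
      have hku : (k : ℝ) ≤ u := ((Nat.cast_le (α := ℝ)).2 (min_le_left _ _)).trans (Nat.floor_le hu0)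
      have huk : u ≤ k + 2 := by
        by_cases hfl : ⌊u⌋₊ ≤ K
        · rw [hk, min_eq_left hfl]; linarith [Nat.lt_floor_add_one u]
        · rw [hk, min_eq_right (le_of_not_ge hfl), show (K : ℝ) + 2 = n by rw [hn]; push_cast; ring]
          exact hun
      refine mem_segment_of_eq_add_mul (μ := (u - k) / 2) (by linarith) (by linarith) ?_
      rw [← hθx, lineMap_apply_complex, ← hnh, hc]
      push_cast
      rw [hu]; push_cast; ring
    · rintro ⟨_, ⟨k, hk, rfl⟩, hx⟩
      exact hpiece_sub k (by omega) hx

/-- **Prop 2.5 (a)**, summary: for an open `U ⊆ ℂ`, the line segments of `(U, 𝒮(U))` are exactly the (traces of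
the) non-degenerate closed segments `[a, b] ⊆ U`. [cite: MochizukiAbsTopIII2015, Proposition 2.5 (a) p.56] -/
theorem Parallelograms.isLineSegment_iff_of_subset {U : Set ℂ} (hU : IsOpen U)
    {𝒬 : Set (Set U)} (h𝒬 : ∀ Q ∈ 𝒬, Subtype.val '' Q ∈ parallelogramsIn U)
    (h𝒮 : ∀ Q : Set U, Subtype.val '' Q ∈ squaresIn U → Q ∈ 𝒬) {L : Set U} :
    Parallelograms.IsLineSegment 𝒬 L ↔
      ∃ a b : ℂ, a ≠ b ∧ segment ℝ a b ⊆ U ∧ L = Subtype.val ⁻¹' segment ℝ a b := by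
  constructor
  · intro hL
    obtain ⟨a, b, hab, hLab⟩ := hL.exists_eq_segment_of_subset hU h𝒬 h𝒮
    refine ⟨a, b, hab, hLab ▸ Subtype.coe_image_subset U L, ?_⟩
    rw [← hLab, preimage_image_eq L Subtype.val_injective]
  · rintro ⟨a, b, hab, hsub, rfl⟩
    exact Parallelograms.isLineSegment_of_segment_subset hU h𝒬 h𝒮 hab hsub

/-- **Prop 2.5 (a)** for `𝒬 = 𝒮(U)`: the line segments of `(U, 𝒮(U))` are exactly the (traces of the)
non-degenerate closed segments `[a, b] ⊆ U`. [cite: MochizukiAbsTopIII2015, Proposition 2.5 (a) p.56] -/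
theorem Parallelograms.isLineSegment_squares_iff {U : Set ℂ} (hU : IsOpen U) {L : Set U} :
    Parallelograms.IsLineSegment {Q : Set U | Subtype.val '' Q ∈ squaresIn U} L ↔
      ∃ a b : ℂ, a ≠ b ∧ segment ℝ a b ⊆ U ∧ L = Subtype.val ⁻¹' segment ℝ a b :=
  Parallelograms.isLineSegment_iff_of_subset hU (fun _ hQ => squaresIn_subset_parallelogramsIn U hQ)
    fun _ h => h

/-- **Prop 2.5 (a)** for `𝒬 = 𝒫(U)`: the line segments of `(U, 𝒫(U))` are exactly the (traces of the)
non-degenerate closed segments `[a, b] ⊆ U`. [cite: MochizukiAbsTopIII2015, Proposition 2.5 (a) p.56] -/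
theorem Parallelograms.isLineSegment_parallelograms_iff {U : Set ℂ} (hU : IsOpen U) {L : Set U} :
    Parallelograms.IsLineSegment {Q : Set U | Subtype.val '' Q ∈ parallelogramsIn U} L ↔
      ∃ a b : ℂ, a ≠ b ∧ segment ℝ a b ⊆ U ∧ L = Subtype.val ⁻¹' segment ℝ a b :=
  Parallelograms.isLineSegment_iff_of_subset hU (fun _ hQ => hQ)
    fun _ h => squaresIn_subset_parallelogramsIn U h

end

end Literature.AnabelianGeometry.AbsoluteAnabelian
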